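import Summits.Ventures.CertifiedManyBodySolver.Downfold.EmeryScaleEdgeBox
import Summits.Ventures.CertifiedManyBodySolver.Downfold.EmeryScaleBoxAssembly
import HarnessLib

/-!
# ASSEMBLY LEMMAS FOR THE TELESCOPED-EDGE / SCALING-RAY CHECKER: a ray stage from its cells, an edge cell from its parts, the box check from its
# cells — so that instance files run ONE `decide` per kernel cell under default heartbeats (INFL-3to1-B §B.91 (d))

Venture CertifiedManyBodySolver, cell `pub/hubbard-downfold` (stage S1; INFLATION-RULES-3to1-B §B.91), seat hubbard-downfold-mod-4 (technique B = band
level, g40); namespace `Summit.Ventures.CertifiedManyBodySolver.Downfold.Emery`. Everything PROVED (0 sorry). WHAT THIS IS NOT: a statement about any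
material; bookkeeping only (the pattern of `EmeryScaleBoxAssembly`).

* `rayStageCheck_of_cells`, `edgeScalars` + `edgeCellOK_true_of_parts` / `edgeCellOK_false_of_parts`, `edgeBoxCheck_of_cells`.

Sources: interval arithmetic [folklore] (Moore 1966).
-/

noncomputable section

namespace Summit.Ventures.CertifiedManyBodySolver.Downfold.Emery

open Real Set Literature.Analysis.ValidatedNumerics.Numerics

/-- A ray stage check from its cells. [folklore] -/
theorem rayStageCheck_of_cells {upper : Bool} {IC famD IA famB W : FI} {sR whlo2 : ℤ} {rays : List RCell}
    (hcov : coversBy RCell.iS 0 sR rays = true) (hall : ∀ rc ∈ rays, rayCellOK upper IC famD IA famB W whlo2 rc = true) :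
    rayStageCheck upper IC famD IA famB W sR whlo2 rays = true := by
  unfold rayStageCheck
  rw [Bool.and_eq_true, List.all_eq_true]
  exact ⟨hcov, hall⟩

/-- The scalar (regime) part of `edgeCellOK`. [folklore] -/
def edgeScalars (IC IA IB : FI) (ec : ECell) : Bool :=
  decide (0 < ec.W.lo) && decide (0 < ec.iD.lo) && decide (0 < IA.lo) && decide (0 ≤ IC.lo) && decide (0 ≤ (IB.sub IC).lo) &&
  decide ((IC.mul (thin ec.W.hi)).hi < (IA.sqr).lo) && decide ((IB.mul ec.iD).hi < ((IA.sqr).mulInt 4).lo)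

/-- An UPPER edge cell check from its parts: value check at `W.lo`, scalars, `t_pp` stage (direction `−1`), ray stages. [folklore] -/
theorem edgeCellOK_true_of_parts {IC IA IB : FI} {wB sR V whlo whlo2 : ℤ} {ec : ECell}
    (hval : valueCheck true IC V ec.nv ⟨ec.iD, IA, IB, thin 0, thin ec.W.lo⟩ = true) (hsc : edgeScalars IC IA IB ec = true)
    (hstage : stageCheck true (thin 0) (thin 0) (thin (-(SC : ℤ))) IC IC whlo ec.iD IA IB ec.W wB (ec.bnodes.map (·.cell)) = true)
    (hrays : ∀ nb ∈ ec.bnodes, rayStageCheck true IC ec.iD IA (famOf IB nb.cell.iS (thin (-(SC : ℤ)))) nb.cell.Wout sR whlo2 nb.rays = true) :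
    edgeCellOK true IC IA IB wB sR V whlo whlo2 ec = true := by
  unfold edgeCellOK
  unfold edgeScalars at hsc
  simp only [Bool.and_eq_true, ↓reduceIte] at hsc ⊢
  obtain ⟨⟨⟨⟨⟨⟨h1, h2⟩, h3⟩, h4⟩, h5⟩, h6⟩, h7⟩ := hsc
  exact ⟨⟨⟨⟨⟨⟨⟨⟨⟨hval, h1⟩, h2⟩, h3⟩, h4⟩, h5⟩, h6⟩, h7⟩, hstage⟩, List.all_eq_true.2 hrays⟩

/-- A LOWER edge cell check from its parts: value check at `W.hi`, scalars, `t_pp` stage (direction `+1`), ray stages. [folklore] -/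
theorem edgeCellOK_false_of_parts {IC IA IB : FI} {wB sR V whlo whlo2 : ℤ} {ec : ECell}
    (hval : valueCheck false IC V ec.nv ⟨ec.iD, IA, IB, thin 0, thin ec.W.hi⟩ = true) (hsc : edgeScalars IC IA IB ec = true)
    (hstage : stageCheck false (thin 0) (thin 0) (thin (SC : ℤ)) IC IC whlo ec.iD IA IB ec.W wB (ec.bnodes.map (·.cell)) = true)
    (hrays : ∀ nb ∈ ec.bnodes, rayStageCheck false IC ec.iD IA (famOf IB nb.cell.iS (thin (SC : ℤ))) nb.cell.Wout sR whlo2 nb.rays = true) :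
    edgeCellOK false IC IA IB wB sR V whlo whlo2 ec = true := by
  unfold edgeCellOK
  unfold edgeScalars at hsc
  simp only [Bool.and_eq_true, Bool.false_eq_true, ↓reduceIte] at hsc ⊢
  obtain ⟨⟨⟨⟨⟨⟨h1, h2⟩, h3⟩, h4⟩, h5⟩, h6⟩, h7⟩ := hsc
  exact ⟨⟨⟨⟨⟨⟨⟨⟨⟨hval, h1⟩, h2⟩, h3⟩, h4⟩, h5⟩, h6⟩, h7⟩, hstage⟩, List.all_eq_true.2 hrays⟩

/-- The box check from its cells. [folklore] -/
theorem edgeBoxCheck_of_cells {upper : Bool} {IC IA IB : FI} {wB sR V whlo whlo2 Dlo Dhi : ℤ} {cells : List ECell}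
    (hcov : coversBy ECell.iD Dlo Dhi cells = true) (hall : ∀ ec ∈ cells, edgeCellOK upper IC IA IB wB sR V whlo whlo2 ec = true) :
    edgeBoxCheck upper IC IA IB wB sR V whlo whlo2 Dlo Dhi cells = true := by
  unfold edgeBoxCheck
  rw [Bool.and_eq_true, List.all_eq_true]
  exact ⟨hcov, hall⟩

end Summit.Ventures.CertifiedManyBodySolver.Downfold.Emery
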